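import Summits.HodgeConjecture.HodgeConjecture.Theorems.F0P3cStCharTSUpDom                    -- ★ p851529 (LH4-p01 g5) S13c head: brings `EllipticData`, `up`, norm fibre ★, (UP-DEF) currency
import Literature.NumberTheory.Rogawski1990.FinExplicitTransferFactorStableInvariance          -- ★ `finTau_eq_of_isLocalStablyConjH`, `finKappaAt_eq_of_isLocalStablyConjH`, `finCharpolyTwo_eq_…`, `finGammaTwo_eq_…`
import HarnessLib

/-!
# F0 · P3c · line LH6 «StCharTS» — «UP-EVAL★» (brick (γ) of S13b «UPR-LC»): the finite sum `∑ᶠ` over stable classes of `H_v` in the (UP-DEF) field equation of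
# `χ ↦ χ^G` is a sum over ANY transversal of the norm fibre, and `up α x = D_G(x)⁻¹ · Σ_{t ∈ S} τ(t) D_H(t) κ(t,x) α(t)` at a regular `x` [Rogawski1990, §4.9 p. 55; §12.5 pp. 182–183]

Cell `pub/hodgecm-mathlib`, crux H413 = `stmt-HodgeConjecture-24833` (lane `--supports … --as helper`), route HCCMUnconditional; seat F0P3-p02 (g20); datum road of the (S-𝔇)
organ `stub_EllipticPackage`; slice S13b «UPR-LC» (PLAN `F0/P3/F0P3-p02/g20/S13b-PLAN.v1.F0P3p02g20.md`), brick (γ) «finsum rewrite»: the template is the support argument inside ★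
`F0P3cStCharTSUpDom.upDom_of_upDef` (LH4-p01 (g5)); here it is exported as an EQUALITY against an arbitrary transversal `S` (pairwise non-stably-conjugate `G`-regular norm
pairs exhausting the fibre — e.g. ★ `exists_finset_normFibre_card_le_three`, or the moved transversal `{s_i(y)}` of S13b), for any stable summand `Φ`.
THEOREMS ONLY (no definition ∕ instance ∕ notation ∕ named fact ∕ `sorry`); ★-only imports.
HONEST LABEL: HC_CM is proved only modulo the 7 printed citations (2 remaining named inputs: hLiu418 = `stmt-HodgeConjecture-24832`, h413 = `stmt-HodgeConjecture-24833`)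
until rung 0 closes; this file closes no organ, count-neutral.

* §1 `isLocalGRegular_of_isLocalStablyConjH`, `isLocalGRegular_iff_of_isLocalStablyConjH` — `G`-regularity is a stable class function on `H_v`;
* §2 `finsum_quot_eq_sum` — `∑ᶠ q, 𝟙[q.out G-regular, ι(q.out) ↔ x] Φ(q.out) = Σ_{t ∈ S} Φ t` for a stable `Φ` and a transversal `S` of the norm fibre of `x`;
* §3 `upSummand_eq_of_isLocalStablyConjH` (the (UP-DEF) summand `τ·D_H·κ·α` is stable), `finsum_upSummand_eq_sum`, and the datum dress
  `up_eq_sum_of_transversal` — under (UP-DEF): `𝔇.up α x = (𝔇.DG x)⁻¹ · Σ_{t ∈ S} finTau t μ · 𝔇.DH t · finKappaAt t x · α t` at a regular `x`.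

## References
* [Rogawski1990] J. D. Rogawski, *Automorphic Representations of Unitary Groups in Three Variables*, Ann. of Math. Stud. 123 (1990): §4.9 p. 55 (the transfer `χ ↦ χ^G` as a sum
  over the `γ_H ↦ γ`, stable conjugacy classes); §5.4 p. 78 (at most three classes transfer to `γ`); §12.5 pp. 182–183 (`χ_ρ^G`, `D_G`, `D_H`).
* [LanglandsShelstad1987] R. P. Langlands, D. Shelstad, *On the definition of transfer factors*, Math. Ann. 278 (1987), §1.3 — background (stable class functions).
-/

set_option autoImplicit false
-- the mandated namespace has the single-problem summit's repeated segment (`HodgeConjecture.HodgeConjecture`)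
set_option linter.dupNamespace false

noncomputable section

open Polynomial
open NumberField IsDedekindDomain
open scoped Matrix MatrixGroups Classical
open Literature.NumberTheory.Rogawski1990 Literature.NumberTheory.Automorphic Literature.NumberTheory.Automorphic.UnitaryGroup
open Literature.NumberTheory.GaloisRepresentations

namespace Summit.HodgeConjecture.HodgeConjecture.Cruxes.H413.F0P3cStCharTSUpEval

variable (L : Type) [Field L] [NumberField L] [IsCMField L] (v : HeightOneSpectrum (𝓞 ↥(maximalRealSubfield L)))

/-! ## §1 `G`-regularity is a stable class function on `H_v` -/

/-- **`G`-regularity of `γ_H ∈ H_v` is a stable class function**: `charpoly ι(γ_H) = χ_g · (X − u)` and both factors are stable class functions (★ `finCharpolyTwo_eq_of_isLocalStablyConjH`,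
★ `finGammaTwo_eq_of_isLocalStablyConjH`, ★ `charpoly_endoEmbLocal`). [cite: Rogawski1990, §3.1 p. 19; §4.3 p. 42] -/
theorem isLocalGRegular_of_isLocalStablyConjH
    {a a' : (UnitaryGroup.cmDatum L 2 (Matrix.of fun i j : Fin 2 => if i.val + j.val + 1 = 2 then (1 : L) else 0)).Local v ×
      (UnitaryGroup.cmDatum L 1 (Matrix.of fun i j : Fin 1 => if i.val + j.val + 1 = 1 then (1 : L) else 0)).Local v}
    (ha : IsLocalGRegular L v a) (h : IsLocalStablyConjH L v a a') : IsLocalGRegular L v a' := by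
  have hsep : (((endoEmbLocal L v a').val.val : Matrix (Fin 3) (Fin 3) (UnitaryGroup.LocalRing L v)).charpoly).Separable := by
    rw [charpoly_endoEmbLocal, finCharpolyTwo_eq_of_isLocalStablyConjH L v h, finGammaTwo_eq_of_isLocalStablyConjH L v h]
    exact IsLocalGRegular.separable_mul L v ha
  exact hsep

/-- `G`-regularity on a stable class: `γ_H ∼_st γ_H′ ⇒ (γ_H′ G-regular ↔ γ_H G-regular)`. [cite: Rogawski1990, §3.1 p. 19] -/
theorem isLocalGRegular_iff_of_isLocalStablyConjH
    {a a' : (UnitaryGroup.cmDatum L 2 (Matrix.of fun i j : Fin 2 => if i.val + j.val + 1 = 2 then (1 : L) else 0)).Local v ×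
      (UnitaryGroup.cmDatum L 1 (Matrix.of fun i j : Fin 1 => if i.val + j.val + 1 = 1 then (1 : L) else 0)).Local v}
    (h : IsLocalStablyConjH L v a a') : IsLocalGRegular L v a' ↔ IsLocalGRegular L v a :=
  ⟨fun ha' => isLocalGRegular_of_isLocalStablyConjH L v ha' h.symm, fun ha => isLocalGRegular_of_isLocalStablyConjH L v ha h⟩

/-! ## §2 The `∑ᶠ` over stable classes is a sum over any transversal of the norm fibre -/

/-- **TRANSVERSAL FORMULA.**  Let `Φ : H_v → ℂ` be a stable class function on the `G`-regular set (`Φ b = Φ a` for `a` `G`-regular, `a ∼_st b`), `x ∈ U(Φ₃)(L⁺_v)`, and `S ⊆ H_v` a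
transversal of the norm fibre of `x`: its elements are `G`-regular and match `x`, are pairwise NOT stably conjugate, and every `G`-regular `γ_H` matching `x` is stably conjugate to one of
them (★ `exists_finset_normFibre_card_le_three` produces one).  Then `∑ᶠ_{q} 𝟙[q.out G-regular ∧ ι(q.out) ↔ x] · Φ(q.out) = Σ_{t ∈ S} Φ t`.
[cite: Rogawski1990, §4.9 p. 55; §5.4 p. 78] -/
theorem finsum_quot_eq_sum (x : Gqs L v)
    (Φ : (UnitaryGroup.cmDatum L 2 (Matrix.of fun i j : Fin 2 => if i.val + j.val + 1 = 2 then (1 : L) else 0)).Local v ×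
      (UnitaryGroup.cmDatum L 1 (Matrix.of fun i j : Fin 1 => if i.val + j.val + 1 = 1 then (1 : L) else 0)).Local v → ℂ)
    (hΦ : ∀ a b, IsLocalGRegular L v a → IsLocalStablyConjH L v a b → Φ b = Φ a)
    (S : Finset ((UnitaryGroup.cmDatum L 2 (Matrix.of fun i j : Fin 2 => if i.val + j.val + 1 = 2 then (1 : L) else 0)).Local v ×
      (UnitaryGroup.cmDatum L 1 (Matrix.of fun i j : Fin 1 => if i.val + j.val + 1 = 1 then (1 : L) else 0)).Local v))
    (hS : ∀ t ∈ S, IsLocalGRegular L v t ∧ IsLocalNormPair L (qsForm L) v t x)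
    (hpair : ∀ t ∈ S, ∀ t' ∈ S, t ≠ t' → ¬ IsLocalStablyConjH L v t t')
    (hexh : ∀ a, IsLocalGRegular L v a → IsLocalNormPair L (qsForm L) v a x → ∃ t ∈ S, IsLocalStablyConjH L v a t) :
    ∑ᶠ q : Quot (IsLocalStablyConjH L v), (if IsLocalGRegular L v q.out ∧ IsLocalNormPair L (qsForm L) v q.out x then Φ q.out else 0) = ∑ t ∈ S, Φ t := by
  -- the equivalence relation and its quotient
  have hEq : Equivalence (IsLocalStablyConjH L v) :=
    ⟨fun a => IsStablyConjH.refl _ _ _ a, fun h => h.symm, fun h h' => h.trans h'⟩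
  have hmk : ∀ a b, Quot.mk (IsLocalStablyConjH L v) a = Quot.mk (IsLocalStablyConjH L v) b ↔ IsLocalStablyConjH L v a b :=
    fun a b => Quot.eq.trans hEq.eqvGen_iff
  have hout' : ∀ a, IsLocalStablyConjH L v (Quot.mk (IsLocalStablyConjH L v) a).out a :=
    fun a => (hmk _ _).1 (Quot.out_eq _)
  set F : Quot (IsLocalStablyConjH L v) → ℂ := fun q =>
    if IsLocalGRegular L v q.out ∧ IsLocalNormPair L (qsForm L) v q.out x then Φ q.out else 0 with hF
  have hsupp : Function.support F ⊆ ((S.image (Quot.mk (IsLocalStablyConjH L v)) : Finset _) : Set _) := by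
    intro q hq
    rw [Function.mem_support] at hq
    by_cases hc : IsLocalGRegular L v q.out ∧ IsLocalNormPair L (qsForm L) v q.out x
    · obtain ⟨t, ht, hqt⟩ := hexh q.out hc.1 hc.2
      rw [Finset.coe_image, Set.mem_image]
      exact ⟨t, by exact_mod_cast ht, ((hmk _ _).2 hqt.symm).trans (Quot.out_eq q)⟩
    · exact absurd (by rw [hF]; exact if_neg hc) hq
  have hinjMk : Set.InjOn (Quot.mk (IsLocalStablyConjH L v)) ↑S := by
    intro t ht t' ht' he
    by_contra hne
    exact hpair t ht t' ht' hne ((hmk _ _).1 he)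
  rw [finsum_eq_finsetSum_of_support_subset F hsupp, Finset.sum_image hinjMk]
  refine Finset.sum_congr rfl fun t ht => ?_
  -- on the class of `t ∈ S` the indicator is on and `Φ(out) = Φ(t)`
  have h1 : IsLocalStablyConjH L v (Quot.mk (IsLocalStablyConjH L v) t).out t := hout' t
  have hreg : IsLocalGRegular L v (Quot.mk (IsLocalStablyConjH L v) t).out :=
    isLocalGRegular_of_isLocalStablyConjH L v (hS t ht).1 h1.symm
  have hnp : IsLocalNormPair L (qsForm L) v (Quot.mk (IsLocalStablyConjH L v) t).out x :=
    (isLocalNormPair_iff_of_isLocalStablyConjH L v (qsForm L) h1.symm x).2 (hS t ht).2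
  simp only [hF]
  rw [if_pos ⟨hreg, hnp⟩]
  exact (hΦ _ _ hreg h1).symm

/-! ## §3 The (UP-DEF) summand and the evaluation of `up α x` on a transversal -/

/-- **The (UP-DEF) summand `τ(γ_H)·D_H(γ_H)·κ(γ_H, x)·α(γ_H)` is a stable class function of `γ_H` on the `G`-regular set** (★ `finTau_eq_of_isLocalStablyConjH`,
★ `finKappaAt_eq_of_isLocalStablyConjH`, the field `hDHst`, and stability of `α`). [cite: Rogawski1990, §4.9 p. 55; §12.5 p. 183] -/
theorem upSummand_eq_of_isLocalStablyConjH (μ : HeckeCharacter L) (x : Gqs L v)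
    (DH : (UnitaryGroup.cmDatum L 2 (Matrix.of fun i j : Fin 2 => if i.val + j.val + 1 = 2 then (1 : L) else 0)).Local v ×
      (UnitaryGroup.cmDatum L 1 (Matrix.of fun i j : Fin 1 => if i.val + j.val + 1 = 1 then (1 : L) else 0)).Local v → ℝ)
    (hDHst : ∀ a b, IsLocalGRegular L v a → IsLocalStablyConjH L v a b → DH b = DH a)
    (α : (UnitaryGroup.cmDatum L 2 (Matrix.of fun i j : Fin 2 => if i.val + j.val + 1 = 2 then (1 : L) else 0)).Local v ×
      (UnitaryGroup.cmDatum L 1 (Matrix.of fun i j : Fin 1 => if i.val + j.val + 1 = 1 then (1 : L) else 0)).Local v → ℂ)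
    (hαst : ∀ a b, IsLocalGRegular L v a → IsLocalStablyConjH L v a b → α b = α a)
    {a b : (UnitaryGroup.cmDatum L 2 (Matrix.of fun i j : Fin 2 => if i.val + j.val + 1 = 2 then (1 : L) else 0)).Local v ×
      (UnitaryGroup.cmDatum L 1 (Matrix.of fun i j : Fin 1 => if i.val + j.val + 1 = 1 then (1 : L) else 0)).Local v}
    (ha : IsLocalGRegular L v a) (h : IsLocalStablyConjH L v a b) :
    finTau L v b μ * (DH b : ℂ) * ((finKappaAt L v (qsForm L) b x : ℤ) : ℂ) * α b =
      finTau L v a μ * (DH a : ℂ) * ((finKappaAt L v (qsForm L) a x : ℤ) : ℂ) * α a := by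
  rw [finTau_eq_of_isLocalStablyConjH L v h μ, finKappaAt_eq_of_isLocalStablyConjH L v (qsForm L) h x, hDHst a b ha h, hαst a b ha h]

/-- **TRANSVERSAL FORMULA for the (UP-DEF) summand**: `∑ᶠ_{q} 𝟙[…] τ·D_H·κ·α (q.out) = Σ_{t ∈ S} τ(t) D_H(t) κ(t,x) α(t)`. [cite: Rogawski1990, §4.9 p. 55; §12.5 p. 183] -/
theorem finsum_upSummand_eq_sum (μ : HeckeCharacter L) (x : Gqs L v)
    (DH : (UnitaryGroup.cmDatum L 2 (Matrix.of fun i j : Fin 2 => if i.val + j.val + 1 = 2 then (1 : L) else 0)).Local v ×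
      (UnitaryGroup.cmDatum L 1 (Matrix.of fun i j : Fin 1 => if i.val + j.val + 1 = 1 then (1 : L) else 0)).Local v → ℝ)
    (hDHst : ∀ a b, IsLocalGRegular L v a → IsLocalStablyConjH L v a b → DH b = DH a)
    (α : (UnitaryGroup.cmDatum L 2 (Matrix.of fun i j : Fin 2 => if i.val + j.val + 1 = 2 then (1 : L) else 0)).Local v ×
      (UnitaryGroup.cmDatum L 1 (Matrix.of fun i j : Fin 1 => if i.val + j.val + 1 = 1 then (1 : L) else 0)).Local v → ℂ)
    (hαst : ∀ a b, IsLocalGRegular L v a → IsLocalStablyConjH L v a b → α b = α a)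
    (S : Finset ((UnitaryGroup.cmDatum L 2 (Matrix.of fun i j : Fin 2 => if i.val + j.val + 1 = 2 then (1 : L) else 0)).Local v ×
      (UnitaryGroup.cmDatum L 1 (Matrix.of fun i j : Fin 1 => if i.val + j.val + 1 = 1 then (1 : L) else 0)).Local v))
    (hS : ∀ t ∈ S, IsLocalGRegular L v t ∧ IsLocalNormPair L (qsForm L) v t x)
    (hpair : ∀ t ∈ S, ∀ t' ∈ S, t ≠ t' → ¬ IsLocalStablyConjH L v t t')
    (hexh : ∀ a, IsLocalGRegular L v a → IsLocalNormPair L (qsForm L) v a x → ∃ t ∈ S, IsLocalStablyConjH L v a t) :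
    ∑ᶠ q : Quot (IsLocalStablyConjH L v),
        (if IsLocalGRegular L v q.out ∧ IsLocalNormPair L (qsForm L) v q.out x then
          finTau L v q.out μ * (DH q.out : ℂ) * ((finKappaAt L v (qsForm L) q.out x : ℤ) : ℂ) * α q.out
        else 0) =
      ∑ t ∈ S, finTau L v t μ * (DH t : ℂ) * ((finKappaAt L v (qsForm L) t x : ℤ) : ℂ) * α t :=
  finsum_quot_eq_sum L v x (fun a => finTau L v a μ * (DH a : ℂ) * ((finKappaAt L v (qsForm L) a x : ℤ) : ℂ) * α a)
    (fun _ _ ha h => upSummand_eq_of_isLocalStablyConjH L v μ x DH hDHst α hαst ha h) S hS hpair hexh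

/-- **DATUM DRESS — `up α x` on a transversal.**  Under the (UP-DEF) field equation of an `EllipticData` on `(U(Φ₃)(L⁺_v), H_v)` with `stConjH = ∼_st`, `G`-regular `⊆ regH`, `D_H` stable on
`G`-regular classes, for a stable class function `α` on `regH` and a REGULAR `x` with a transversal `S` of its norm fibre:
`𝔇.up α x = (𝔇.DG x)⁻¹ · Σ_{t ∈ S} finTau t μ · 𝔇.DH t · finKappaAt t x · α t`. [cite: Rogawski1990, §4.9 p. 55; §12.5 pp. 182–183] -/
theorem up_eq_sum_of_transversal (μ : HeckeCharacter L)
    [MeasurableSpace (Gqs L v)] [∀ γ : Gqs L v, MeasurableSpace (Gqs L v ⧸ Subgroup.centralizer ({γ} : Set (Gqs L v)))]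
    [MeasurableSpace (Gqs L v ⧸ Subgroup.center (Gqs L v))]
    [MeasurableSpace ((UnitaryGroup.cmDatum L 2 (Matrix.of fun i j : Fin 2 => if i.val + j.val + 1 = 2 then (1 : L) else 0)).Local v ×
      (UnitaryGroup.cmDatum L 1 (Matrix.of fun i j : Fin 1 => if i.val + j.val + 1 = 1 then (1 : L) else 0)).Local v)]
    (𝔇 : Ch12Sec5.EllipticData (Gqs L v)
      ((UnitaryGroup.cmDatum L 2 (Matrix.of fun i j : Fin 2 => if i.val + j.val + 1 = 2 then (1 : L) else 0)).Local v ×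
        (UnitaryGroup.cmDatum L 1 (Matrix.of fun i j : Fin 1 => if i.val + j.val + 1 = 1 then (1 : L) else 0)).Local v))
    (hStH : ∀ a b, 𝔇.stConjH a b ↔ IsLocalStablyConjH L v a b)
    (hRegH : ∀ a, IsLocalGRegular L v a → a ∈ 𝔇.regH)
    (hDHst : ∀ a b, IsLocalGRegular L v a → IsLocalStablyConjH L v a b → 𝔇.DH b = 𝔇.DH a)
    (hUp : ∀ (α : ((UnitaryGroup.cmDatum L 2 (Matrix.of fun i j : Fin 2 => if i.val + j.val + 1 = 2 then (1 : L) else 0)).Local v ×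
        (UnitaryGroup.cmDatum L 1 (Matrix.of fun i j : Fin 1 => if i.val + j.val + 1 = 1 then (1 : L) else 0)).Local v) → ℂ) (x : Gqs L v),
      𝔇.up α x =
        if IsRegularElt (x.val : GL (Fin 3) (UnitaryGroup.LocalRing L v)) then
          ((𝔇.DG x : ℂ))⁻¹ *
            ∑ᶠ q : Quot (IsLocalStablyConjH L v),
              (if IsLocalGRegular L v q.out ∧ IsLocalNormPair L (qsForm L) v q.out x then
                finTau L v q.out μ * (𝔇.DH q.out : ℂ) * ((finKappaAt L v (qsForm L) q.out x : ℤ) : ℂ) * α q.out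
              else 0)
        else 0)
    (α : ((UnitaryGroup.cmDatum L 2 (Matrix.of fun i j : Fin 2 => if i.val + j.val + 1 = 2 then (1 : L) else 0)).Local v ×
        (UnitaryGroup.cmDatum L 1 (Matrix.of fun i j : Fin 1 => if i.val + j.val + 1 = 1 then (1 : L) else 0)).Local v) → ℂ)
    (hα : Ch12Sec5.IsStableClassFunOn 𝔇.stConjH 𝔇.regH α)
    (x : Gqs L v) (hx : IsRegularElt (x.val : GL (Fin 3) (UnitaryGroup.LocalRing L v)))
    (S : Finset ((UnitaryGroup.cmDatum L 2 (Matrix.of fun i j : Fin 2 => if i.val + j.val + 1 = 2 then (1 : L) else 0)).Local v ×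
      (UnitaryGroup.cmDatum L 1 (Matrix.of fun i j : Fin 1 => if i.val + j.val + 1 = 1 then (1 : L) else 0)).Local v))
    (hS : ∀ t ∈ S, IsLocalGRegular L v t ∧ IsLocalNormPair L (qsForm L) v t x)
    (hpair : ∀ t ∈ S, ∀ t' ∈ S, t ≠ t' → ¬ IsLocalStablyConjH L v t t')
    (hexh : ∀ a, IsLocalGRegular L v a → IsLocalNormPair L (qsForm L) v a x → ∃ t ∈ S, IsLocalStablyConjH L v a t) :
    𝔇.up α x = ((𝔇.DG x : ℂ))⁻¹ * ∑ t ∈ S, finTau L v t μ * (𝔇.DH t : ℂ) * ((finKappaAt L v (qsForm L) t x : ℤ) : ℂ) * α t := by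
  have hαst : ∀ a b, IsLocalGRegular L v a → IsLocalStablyConjH L v a b → α b = α a :=
    fun a b ha h => hα.2 a (hRegH a ha) b ((hStH a b).2 h)
  rw [hUp, if_pos hx, finsum_upSummand_eq_sum L v μ x 𝔇.DH hDHst α hαst S hS hpair hexh]

end Summit.HodgeConjecture.HodgeConjecture.Cruxes.H413.F0P3cStCharTSUpEval

end
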